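import Literature.MathematicalPhysics.QuantumFieldTheory.Balaban1983to89.Node00.BackgroundActionT

/-!
# Lens-2 g4 — K2 PRE-CHECK: the one definition the ZERO-INPUT SPLIT owes (D𝓝⁰), elaborated against the tree TODAY

`mainTermT` = print's main term `−(1/g_k²) A(U_k(V))` ([I] (1.3), p. 260) as a level-`k` density;
`zeroInputMergedTermT` = (1.6) with the accumulated small actions 𝐄_k SWITCHED OFF: VERBATIM `Node00.mergedTermT` with the level-`k` action
`effActionHT … k` replaced by its main term in BOTH places (inside `nextAction` = the body of (0.19), and in the subtraction);
`zeroInputMergedTermFamilyT` / `…MatT` = the β-layer ∕ matrix-carrier exports, mirrors of `mergedTermFamilyT` ∕ `mergedTermFamilyMatT`, so that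
DEF-1's wrapper `recordΦf` (θ-route around `mergedTermFamilyMatT`) has a twin `recordΦf⁰` around `zeroInputMergedTermFamilyMatT`.
`EkT` = 𝐄_k over a generic transport and torus index (K-generic twin of `EkOfRecordT`), and the kernel identity `dChannel_eq`:
  𝓓_{k+1}(W) := 𝓝_{k+1}(W) − 𝓝⁰_{k+1}(W) = [𝐓_k(A_k) − 𝐓_k(A⁰_k)](W) − 𝐄_k(Ū^k U_{k+1} W)
— the HISTORY CHANNEL is exactly «response of the one-step map (0.19) to the input 𝐄_k» minus «𝐄_k transported to the new background»,
print's (1.6) structure ([I] p. 261; [II] (1.4)–(1.6)).  Count-neutral scratch; nothing of Bałaban asserted; definitions + `ring` only.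
-/

namespace Summit.QuantumFields.YangMills.Cruxes.Record13SepCoPHInhabited.Lens2G4

open Literature.MathematicalPhysics.QuantumFieldTheory.Balaban1983to89
open Literature.MathematicalPhysics.QuantumFieldTheory.Balaban1983to89.Node00
open B12Eq019ActionBody (nextAction wilsonTerm)
open T4Continuum (T4Family)
open T4FlagMemory (extd)

noncomputable section

variable (F : T4Family) (N : ℕ) [NeZero N]

/-- Print's MAIN TERM `−(1/g_k²) A(U_k(V))` of the effective action at level `k` ([I] (1.3) p. 260), over the background of record `Uk`
and the `d = 4` Wilson action `wilsonAction4`; K-generic (cf. `wilsonBGOfRecord`, which fixes `p.K`). [cite: Balaban1987RG1, (1.3) p.260] -/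
def mainTermT (ε : ℝ) (K : ℕ) (g : ℕ → ℝ) (k : ℕ) : Density (F.P K) k (SU N) :=
  fun V => -(1 / (g k) ^ 2) * wilsonAction4 (Uk F N K k ε V)

/-- 𝐄_k over a generic transport, K-generic: `A_k + (1/g_k²) A(U_k)` ((0.22) as a definition; twin of `EkOfRecordT`).
[cite: Balaban1987RG1, (0.22) p.256] -/
def EkT (T : Transport F N) (χ : (K : ℕ) → (ℕ → ℝ) → (k : ℕ) → Density (F.P K) k (SU N)) (ε : ℝ) (K : ℕ) (g : ℕ → ℝ) (k : ℕ)
    (V : GaugeField (F.P K) k (SU N)) : ℝ :=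
  effActionHT F N T χ K g k V + (1 / (g k) ^ 2) * wilsonAction4 (Uk F N K k ε V)

/-- `A_k = A⁰_k + 𝐄_k` pointwise (definition chasing). [cite: Balaban1987RG1, (1.3) p.260 (bookkeeping)] -/
theorem effActionHT_eq_main_add_Ek (T : Transport F N) (χ : (K : ℕ) → (ℕ → ℝ) → (k : ℕ) → Density (F.P K) k (SU N)) (ε : ℝ)
    (K : ℕ) (g : ℕ → ℝ) (k : ℕ) (V : GaugeField (F.P K) k (SU N)) :
    effActionHT F N T χ K g k V = mainTermT F N ε K g k V + EkT F N T χ ε K g k V := by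
  unfold mainTermT EkT; ring

/-- **D𝓝⁰ — the ZERO-INPUT one-step output** 𝓝⁰_{k+1}(W) := log[(T_k χ_k e^{−GF/g_k² + A⁰_k})(W)/𝐍⁰_k] − A⁰_k(Ū^k U_{k+1} W):
(1.6) with 𝐄_k switched off — VERBATIM `mergedTermT` with `effActionHT … k` replaced by `mainTermT … k` in both places.
[cite: Balaban1987RG1, (1.6) p.261; (0.19) p.255] -/
def zeroInputMergedTermT (T : Transport F N) (χ : (K : ℕ) → (ℕ → ℝ) → (k : ℕ) → Density (F.P K) k (SU N)) (ε : ℝ) (K : ℕ)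
    (g : ℕ → ℝ) (k : ℕ) (W : GaugeField (F.P K) (k + 1) (SU N)) : ℝ :=
  nextAction (T K k) (χ K g k) (gfOfRecord F N K k) (g k) (mainTermT F N ε K g k) W
    - mainTermT F N ε K g k (Averaging.iter (avOfRecord F N K) k (Uk F N K (k + 1) ε W))

/-- β-layer export of 𝓝⁰ (mirror of `mergedTermFamilyT`). [cite: Balaban1987RG1, (1.20)–(1.22) p.264] -/
def zeroInputMergedTermFamilyT (T : Transport F N) (χ : (K : ℕ) → (ℕ → ℝ) → (k : ℕ) → Density (F.P K) k (SU N)) (ε : ℝ)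
    {𝔄 : Type*} (r : 𝔄 → SU N) :
    (k : ℕ) → (Fin (k + 1) → ℝ) → (K : ℕ) → ((Fin (F.P K).d → Site (F.P K) (k + 1) → 𝔄) → ℝ) :=
  fun k hist K W => zeroInputMergedTermT F N T χ ε K (extd hist) k (readField F N r W)

/-- Matrix-carrier export of 𝓝⁰ (mirror of `mergedTermFamilyMatT`; the species DEF-1's θ-route wrapper consumes). [cite: Balaban1987RG1, (1.20) p.264] -/
def zeroInputMergedTermFamilyMatT (T : Transport F N) (χ : (K : ℕ) → (ℕ → ℝ) → (k : ℕ) → Density (F.P K) k (SU N)) (ε : ℝ) :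
    (k : ℕ) → (Fin (k + 1) → ℝ) → (K : ℕ) → ((Fin (F.P K).d → Site (F.P K) (k + 1) → Matrix (Fin N) (Fin N) ℂ) → ℝ) :=
  zeroInputMergedTermFamilyT F N T χ ε (suOfMat N)

/-- **The HISTORY CHANNEL, kernel identity.** 𝓓_{k+1}(W) := 𝓝_{k+1}(W) − 𝓝⁰_{k+1}(W)
= [𝐓_k(A_k)(W) − 𝐓_k(A⁰_k)(W)] − 𝐄_k(Ū^k U_{k+1} W): the response of the one-step map (0.19) to the input 𝐄_k, minus 𝐄_k transported
to the new background — by `effActionHT_succ` (rfl) and `ring`. [cite: Balaban1987RG1, (1.6) p.261 (bookkeeping)] -/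
theorem dChannel_eq (T : Transport F N) (χ : (K : ℕ) → (ℕ → ℝ) → (k : ℕ) → Density (F.P K) k (SU N)) (ε : ℝ) (K : ℕ)
    (g : ℕ → ℝ) (k : ℕ) (W : GaugeField (F.P K) (k + 1) (SU N)) :
    mergedTermT F N T χ ε K g k W - zeroInputMergedTermT F N T χ ε K g k W =
      (nextAction (T K k) (χ K g k) (gfOfRecord F N K k) (g k) (effActionHT F N T χ K g k) W
        - nextAction (T K k) (χ K g k) (gfOfRecord F N K k) (g k) (mainTermT F N ε K g k) W)
      - EkT F N T χ ε K g k (Averaging.iter (avOfRecord F N K) k (Uk F N K (k + 1) ε W)) := by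
  unfold mergedTermT zeroInputMergedTermT EkT mainTermT
  rw [effActionHT_succ]
  ring

/-- (B0)-shape at the first level: `A_0 = wilsonTerm (g 0) 1` (tree, rfl) and the main term at level 0 agree on every `V` with
`Uk F N K 0 ε V = V` (the background of a level-0 field is itself on the small-field region — an S-size lemma about `Uk`, NOT proved
here; this records only the implication). [cite: Balaban1987RG1, (0.17) p.255 (bookkeeping)] -/
theorem mainTermT_zero_of_Uk_id (T : Transport F N) (χ : (K : ℕ) → (ℕ → ℝ) → (k : ℕ) → Density (F.P K) k (SU N)) (ε : ℝ) (K : ℕ)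
    (g : ℕ → ℝ) (V : GaugeField (F.P K) 0 (SU N)) (hU : Uk F N K 0 ε V = V) :
    mainTermT F N ε K g 0 V = effActionHT F N T χ K g 0 V := by
  rw [effActionHT_zero]
  simp [mainTermT, hU, wilsonAction4]

/-- … equivalently 𝐄_0 vanishes there. [cite: Balaban1987RG1, (0.17) p.255 (bookkeeping)] -/
theorem EkT_zero_of_Uk_id (T : Transport F N) (χ : (K : ℕ) → (ℕ → ℝ) → (k : ℕ) → Density (F.P K) k (SU N)) (ε : ℝ) (K : ℕ)
    (g : ℕ → ℝ) (V : GaugeField (F.P K) 0 (SU N)) (hU : Uk F N K 0 ε V = V) :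
    EkT F N T χ ε K g 0 V = 0 := by
  have h := effActionHT_eq_main_add_Ek F N T χ ε K g 0 V
  rw [mainTermT_zero_of_Uk_id F N T χ ε K g V hU] at h
  linarith


/-! ## §2. CRIT-1's binding condition K1″ (HOME STATUS l.3536) met STRUCTURALLY: ONE named one-step functional `stepOutT` with the
level-`k` INPUT ACTION explicit; 𝓝 and 𝓝⁰ are its values at `A_k` resp. `A⁰_k := A_k − 𝐄_k` (the tree's own (0.22) split), both by `rfl`;
hence `𝓝 − 𝓝⁰ = R(A⁰_k + 𝐄_k) − R(A⁰_k)` is homogeneous in the input BY CONSTRUCTION — every history-free activity of (2.14) (P-terms,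
localisation terms) lands in 𝓝⁰ automatically; no hand-picked list of «main terms» enters (U-b is a print-label question only). -/

/-- **The one-step functional of record with EXPLICIT input action** `R_k(A)(W) := log[(T_k χ_k e^{−GF/g_k² + A})(W)/𝐍_k(A)] − A(Ū^k U_{k+1} W)`
= (0.19) followed by the subtraction of (1.6), as a function of the level-`k` action `A`. [cite: Balaban1987RG1, (0.19) p.255, (1.6) p.261] -/
def stepOutT (T : Transport F N) (χ : (K : ℕ) → (ℕ → ℝ) → (k : ℕ) → Density (F.P K) k (SU N)) (ε : ℝ) (K : ℕ) (g : ℕ → ℝ) (k : ℕ)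
    (A : Density (F.P K) k (SU N)) (W : GaugeField (F.P K) (k + 1) (SU N)) : ℝ :=
  nextAction (T K k) (χ K g k) (gfOfRecord F N K k) (g k) A W - A (Averaging.iter (avOfRecord F N K) k (Uk F N K (k + 1) ε W))

/-- 𝓝_{k+1} = R_k(A_k) — `rfl` (with `effActionHT_succ`). [cite: Balaban1987RG1, (1.6) p.261 (bookkeeping)] -/
theorem mergedTermT_eq_stepOut (T : Transport F N) (χ : (K : ℕ) → (ℕ → ℝ) → (k : ℕ) → Density (F.P K) k (SU N)) (ε : ℝ) (K : ℕ)
    (g : ℕ → ℝ) (k : ℕ) (W : GaugeField (F.P K) (k + 1) (SU N)) :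
    mergedTermT F N T χ ε K g k W = stepOutT F N T χ ε K g k (effActionHT F N T χ K g k) W := rfl

/-- 𝓝⁰_{k+1} = R_k(A⁰_k) — `rfl`. [cite: Balaban1987RG1, (1.6) p.261 (bookkeeping)] -/
theorem zeroInputMergedTermT_eq_stepOut (T : Transport F N) (χ : (K : ℕ) → (ℕ → ℝ) → (k : ℕ) → Density (F.P K) k (SU N)) (ε : ℝ)
    (K : ℕ) (g : ℕ → ℝ) (k : ℕ) (W : GaugeField (F.P K) (k + 1) (SU N)) :
    zeroInputMergedTermT F N T χ ε K g k W = stepOutT F N T χ ε K g k (mainTermT F N ε K g k) W := rfl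

/-- The input split is the TREE's (0.22): `A_k = A⁰_k + 𝐄_k` as densities (so 𝓝 = R(A⁰ + 𝐄_k), 𝓝⁰ = R(A⁰ + 0)). [cite: Balaban1987RG1, (0.22) p.256 (bookkeeping)] -/
theorem effActionHT_eq_main_add_Ek_fun (T : Transport F N) (χ : (K : ℕ) → (ℕ → ℝ) → (k : ℕ) → Density (F.P K) k (SU N)) (ε : ℝ)
    (K : ℕ) (g : ℕ → ℝ) (k : ℕ) :
    effActionHT F N T χ K g k = mainTermT F N ε K g k + EkT F N T χ ε K g k := by
  funext V; exact effActionHT_eq_main_add_Ek F N T χ ε K g k V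

/-- 𝓝 as the step functional at history `h := 𝐄_k` and 𝓝⁰ at history `0`, for the SAME `R_k(A⁰_k + ·)` — K1″'s two displayed identities
(the first by the (0.22) split, the second by `add_zero`). [cite: Balaban1987RG1, (1.6) p.261 (bookkeeping)] -/
theorem mergedTermT_eq_stepOut_hist (T : Transport F N) (χ : (K : ℕ) → (ℕ → ℝ) → (k : ℕ) → Density (F.P K) k (SU N)) (ε : ℝ) (K : ℕ)
    (g : ℕ → ℝ) (k : ℕ) (W : GaugeField (F.P K) (k + 1) (SU N)) :
    mergedTermT F N T χ ε K g k W = stepOutT F N T χ ε K g k (mainTermT F N ε K g k + EkT F N T χ ε K g k) W ∧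
    zeroInputMergedTermT F N T χ ε K g k W = stepOutT F N T χ ε K g k (mainTermT F N ε K g k + 0) W := by
  refine ⟨?_, by rw [add_zero]; rfl⟩
  rw [mergedTermT_eq_stepOut, effActionHT_eq_main_add_Ek_fun F N T χ ε K g k]

/-- The one-step map (0.19) reads its input action only on the support of `χ_k`: two inputs that agree wherever `χ_k ≠ 0` give the same
`𝐓_k`-image (the integrand carries the factor `χ_k(U)`). [cite: Balaban1987RG1, (0.19) p.255 (bookkeeping)] -/
theorem nextAction_congr_support {P : Params} {G : Type*} [GaugeGroup G] {k : ℕ} (T : Density P k G → Density P (k + 1) G)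
    (χ GF : Density P k G) (gk : ℝ) (A A' : Density P k G) (h : ∀ U, χ U ≠ 0 → A U = A' U) :
    nextAction T χ GF gk A = nextAction T χ GF gk A' := by
  have hI : B12Eq019ActionBody.integrand χ GF gk A = B12Eq019ActionBody.integrand χ GF gk A' := by
    funext U
    by_cases hχ : χ U = 0
    · simp [B12Eq019ActionBody.integrand, hχ]
    · simp [B12Eq019ActionBody.integrand, h U hχ]
  unfold nextAction B12Eq019ActionBody.normConst
  rw [hI]

/-- **CRIT-1's k = 0 falsifier, discharged to two S-leaves about `Uk`**: at the first level the history channel VANISHES —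
𝓝_1 = 𝓝⁰_1 — as soon as (i) the background of a level-0 field in the support of `χ_0` is the field itself and (ii) the same holds at the
0-fold average of the new background `U_1(W)` (both instances of «`U_0(V) = V` on the small-field region», [I] (0.21) at k = 0).
[cite: Balaban1987RG1, (0.17) p.255, (0.21) p.256 (bookkeeping)] -/
theorem dChannel_zero_at_first_level (T : Transport F N) (χ : (K : ℕ) → (ℕ → ℝ) → (k : ℕ) → Density (F.P K) k (SU N)) (ε : ℝ)
    (K : ℕ) (g : ℕ → ℝ) (W : GaugeField (F.P K) 1 (SU N))
    (h₁ : ∀ V : GaugeField (F.P K) 0 (SU N), χ K g 0 V ≠ 0 → Uk F N K 0 ε V = V)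
    (h₂ : Uk F N K 0 ε (Averaging.iter (avOfRecord F N K) 0 (Uk F N K 1 ε W)) = Averaging.iter (avOfRecord F N K) 0 (Uk F N K 1 ε W)) :
    mergedTermT F N T χ ε K g 0 W = zeroInputMergedTermT F N T χ ε K g 0 W := by
  have hA : nextAction (T K 0) (χ K g 0) (gfOfRecord F N K 0) (g 0) (effActionHT F N T χ K g 0) =
      nextAction (T K 0) (χ K g 0) (gfOfRecord F N K 0) (g 0) (mainTermT F N ε K g 0) :=
    nextAction_congr_support _ _ _ _ _ _ fun V hV => (mainTermT_zero_of_Uk_id F N T χ ε K g V (h₁ V hV)).symm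
  have hE := EkT_zero_of_Uk_id F N T χ ε K g (Averaging.iter (avOfRecord F N K) 0 (Uk F N K 1 ε W)) h₂
  have hD := dChannel_eq F N T χ ε K g 0 W
  rw [hA, hE, sub_self, sub_zero] at hD
  linarith

/-! ## §3. The two `Uk` leaves of the k = 0 falsifier, reduced further: at level 0 the background of record of a REGULAR field is the
field itself (kernel, from `iter_Uk` and `Averaging.iter _ 0 = id`), so (h₁) = «supp χ_0 ⊆ bgReg_0» and (h₂) = «U_1(W) ∈ bgReg_0» (true near
W = 1: `bgReg` is an open plaquette condition and `U_1(1) = 1`; continuity of the minimiser is [B11] content). -/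

/-- `U_0(V)` exists for every level-0 field in the regularity class: `V` itself solves (0.21) at k = 0 (the constraint set `{Ū⁰ = V}` is `{V}`).
[cite: Balaban1987RG1, (0.21) p.256 (bookkeeping)] -/
theorem ukExists_zero_of_mem_bgReg {K : ℕ} {ε : ℝ} {V : GaugeField (F.P K) 0 (SU N)} (hV : V ∈ bgReg F N K 0 ε) :
    UkExists F N K 0 ε V :=
  ⟨V, rfl, hV, fun U _ hUV => by rw [show U = V from hUV]⟩

/-- **At level 0 the background of record of a regular field is the field**: `U_0(V) = V` for `V ∈ bgReg_0` (kernel: `iter_Uk` at k = 0,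
where `Ū⁰ = id`). [cite: Balaban1987RG1, (0.21) p.256 (bookkeeping)] -/
theorem Uk_zero_eq_self {K : ℕ} {ε : ℝ} {V : GaugeField (F.P K) 0 (SU N)} (hV : V ∈ bgReg F N K 0 ε) : Uk F N K 0 ε V = V :=
  iter_Uk (ukExists_zero_of_mem_bgReg F N hV)

/-- The k = 0 falsifier in its FINAL form: 𝓝_1(W) = 𝓝⁰_1(W) whenever supp χ_0 ⊆ bgReg_0 (the small-field characteristic function of record
lives inside the plaquette-regularity class — [I] (0.8)/(1.2)) and the new background `U_1(W)` is level-0-regular (true on a neighbourhood of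
W = 1).  [cite: Balaban1987RG1, (0.17) p.255, (0.21) p.256, (1.2) p.260 (bookkeeping)] -/
theorem dChannel_zero_at_first_level' (T : Transport F N) (χ : (K : ℕ) → (ℕ → ℝ) → (k : ℕ) → Density (F.P K) k (SU N)) (ε : ℝ)
    (K : ℕ) (g : ℕ → ℝ) (W : GaugeField (F.P K) 1 (SU N))
    (hχ : ∀ V : GaugeField (F.P K) 0 (SU N), χ K g 0 V ≠ 0 → V ∈ bgReg F N K 0 ε)
    (hW : Uk F N K 1 ε W ∈ bgReg F N K 0 ε) :
    mergedTermT F N T χ ε K g 0 W = zeroInputMergedTermT F N T χ ε K g 0 W :=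
  dChannel_zero_at_first_level F N T χ ε K g W (fun V hV => Uk_zero_eq_self F N (hχ V hV)) (Uk_zero_eq_self F N hW)
end

end Summit.QuantumFields.YangMills.Cruxes.Record13SepCoPHInhabited.Lens2G4
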